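import Literature.NumberTheory.Automorphic.JacquetLengthTwoLabels
import Literature.NumberTheory.Automorphic.JacquetLineCases
import Literature.NumberTheory.Automorphic.JacquetModuleFrobeniusProofs
import HarnessLib

/-!
# The labelled pair of a length-two `i_P^G σ` from the EMBEDDING property of its constituents ([Casselman1995] Cor. 6.3.9 (b) + §7.1), one call

Generic representation theory (theorems only).  For `ρ = i_P^G σ` (★ `Representation.normalizedInd`) smooth, `N_P` the union of its compact open subgroups,
`δ_P|_{N_P} = 1`, a `G`-stable `⊥ ≠ N ≠ ⊤` of `ρ` in a lattice without 3-chains, `r(ρ)` two-dimensional with a stable line `θ₁` and quotient character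
`θ₂ ≠ θ₁`, and Casselman's Cor. 6.3.9 (b) in the shape «every constituent of `ρ` embeds into `i_P^G σ` or into `i_P^G σ'`» (hypothesis `hemb`): there
are classes `πs ≠ πn`, the constituents of `ρ` are exactly `πn, πs`, and `r(πs) ≅ θ₂`, `r(πn) ≅ θ₁` (for representatives).  Which of `ρ|_N`, `ρ⁄N` is `πs`
is decided by ★ `normalizedJacquet_sub_quot_cases_of_line` (both Jacquet modules are non-zero by Frobenius reciprocity ★
`frobenius_normalizedInd_holds`: `ρ|_N ↪ ρ`, and `ρ⁄N ≅ r ↪ i(σ)` or `i(σ')` by `hemb`).  NO square-integrability ∕ matrix-coefficient input.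
Written for the T3 «KeysCaseTwo» pay-down of cell pub/hodgecm-mathlib F0∕P3 (stub S2 modulo N1, N2, N3), automorphic-free; line data FIRST in the
argument list (elaboration-cost control at the CM carrier).

## References
[Casselman1995] §3.2 (3.2.3, 3.2.4), §6.3 Cor. 6.3.9, §6.4, §7.1 L. 7.1.1, Cor. 7.1.2 · [BernsteinZelevinsky1977] Prop. 1.9, Thm 2.9, Cor. 2.13 (c) ·
[BushnellHenniart2006] §2.
-/

set_option autoImplicit false

noncomputable section

open scoped MonoidAlgebra
open Literature.RepresentationTheory.FiniteGroups Literature.RepresentationTheory.Semisimple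

namespace Literature.NumberTheory.Automorphic

namespace IrrClass

/-- Frobenius reciprocity turns an injective `G`-map `π ↪ i_P^G σ` from a non-zero smooth `π` into `r(π) ≠ 0`.
[cite: Casselman1995, Thm 3.2.4] [cite: BernsteinZelevinsky1977, Prop. 1.9 (b)] -/
theorem nontrivial_coinvariants_of_injective_normalizedInd {G : Type*} [Group G] [TopologicalSpace G] [IsTopologicalGroup G]
    (t : ParabolicTriple G) [LocallyCompactSpace t.P] (hδ : ∀ (n : G) (hn : n ∈ t.N), deltaChar t.P ⟨n, t.N_le hn⟩ = 1)
    {W : Type*} [AddCommGroup W] [Module ℂ W] (σ : Representation ℂ ↥t.M W)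
    {V : Type*} [AddCommGroup V] [Module ℂ V] [Nontrivial V] (π : Representation ℂ G V) (hπ : π.IsSmooth)
    (f : π.IntertwiningMap (Representation.normalizedInd t σ)) (hf : Function.Injective f) :
    Nontrivial (t.restrict π).Coinvariants := by
  obtain ⟨e⟩ := Representation.frobenius_normalizedInd_holds t hδ π σ hπ
  have hf0 : f ≠ 0 := by
    intro h0
    obtain ⟨x, hx⟩ := exists_ne (0 : V)
    exact hx (hf (by rw [h0, map_zero]; rfl))
  have hφ : e f ≠ 0 := fun h0 => hf0 ((LinearEquiv.map_eq_zero_iff e).1 h0)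
  by_contra htriv
  rw [not_nontrivial_iff_subsingleton] at htriv
  exact hφ (Representation.IntertwiningMap.ext (LinearMap.ext fun x => by rw [Subsingleton.elim x 0, map_zero]; rfl))

/-- **THE LABELLED PAIR OF `i_P^G σ` FROM THE EMBEDDING PROPERTY** (see the module docstring).  Output = the shape of stub S2:
`∃ πs πn, πs ≠ πn ∧ (constituents = {πn, πs}) ∧ (∃ r, ⟦r⟧ = πs ∧ r(r) ≅ θ₂) ∧ (∃ r, ⟦r⟧ = πn ∧ r(r) ≅ θ₁)`.
[cite: Casselman1995, L. 7.1.1 (a), Cor. 7.1.2, Cor. 6.3.9 (b), Prop. 6.4.1, Thm 3.2.4] [cite: BernsteinZelevinsky1977, Prop. 1.9, Cor. 2.13 (c)] -/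
theorem labelledPair_exists_of_line_normalizedInd {G : Type} [Group G] [TopologicalSpace G] [IsTopologicalGroup G]
    (t : ParabolicTriple G) [LocallyCompactSpace t.P] {W : Type} [AddCommGroup W] [Module ℂ W] {σ : Representation ℂ ↥t.M W}
    {W' : Type} [AddCommGroup W'] [Module ℂ W'] {σ' : Representation ℂ ↥t.M W'} {θ₁ θ₂ : ↥t.M →* ℂˣ}
    (hfd : FiniteDimensional ℂ (t.restrict (Representation.normalizedInd t σ)).Coinvariants)
    (h2 : Module.finrank ℂ (t.restrict (Representation.normalizedInd t σ)).Coinvariants = 2)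
    (ℓ : Submodule ℂ (t.restrict (Representation.normalizedInd t σ)).Coinvariants) (hℓ1 : Module.finrank ℂ ↥ℓ = 1)
    (hℓ : ∀ (m : ↥t.M), ∀ x ∈ ℓ, (Representation.normalizedInd t σ).normalizedJacquet t m x = ((θ₁ m : ℂˣ) : ℂ) • x)
    (hq : ∀ (m : ↥t.M) (x : (t.restrict (Representation.normalizedInd t σ)).Coinvariants),
      (Representation.normalizedInd t σ).normalizedJacquet t m x - ((θ₂ m : ℂˣ) : ℂ) • x ∈ ℓ)
    (hNlim : IsLimitOfCompactOpen t.N) (hδ : ∀ (n : G) (hn : n ∈ t.N), deltaChar t.P ⟨n, t.N_le hn⟩ = 1)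
    (hρ : (Representation.normalizedInd t σ).IsSmooth) (N : Subrepresentation (Representation.normalizedInd t σ))
    (hNb : N ≠ ⊥) (hNt : N ≠ ⊤)
    (hlen : ∀ N₁ N₂ : Subrepresentation (Representation.normalizedInd t σ), ¬ (⊥ < N₁ ∧ N₁ < N₂ ∧ N₂ < ⊤))
    (hne : θ₁ ≠ θ₂)
    (hemb : ∀ c : IrrClass G, c.IsConstituentOf (Representation.normalizedInd t σ) → ∃ r : SmoothIrrep G, IrrClass.mk r = c ∧
      ((∃ f : r.ρ.IntertwiningMap (Representation.normalizedInd t σ), Function.Injective f) ∨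
        (∃ f : r.ρ.IntertwiningMap (Representation.normalizedInd t σ'), Function.Injective f))) :
    ∃ πs πn : IrrClass G, πs ≠ πn ∧
      (∀ c : IrrClass G, c.IsConstituentOf (Representation.normalizedInd t σ) ↔ (c = πn ∨ c = πs)) ∧
      (∃ r : SmoothIrrep G, IrrClass.mk r = πs ∧
        Nonempty ((r.ρ.normalizedJacquet t).Equiv ((Representation.trivial ℂ ↥t.M ℂ).twist θ₂))) ∧
      (∃ r : SmoothIrrep G, IrrClass.mk r = πn ∧
        Nonempty ((r.ρ.normalizedJacquet t).Equiv ((Representation.trivial ℂ ↥t.M ℂ).twist θ₁))) := by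
  have hN : N.toRepresentation.IsIrreducible := isIrreducible_toRepresentation_of_forall_not_lt_lt hlen hNb hNt
  have hQ : N.quotientRep.IsIrreducible := isIrreducible_quotientRep_of_forall_not_lt_lt hlen hNb hNt
  let rs : SmoothIrrep G := SmoothIrrep.mk ↥N.toSubmodule N.toRepresentation hN (hρ.toRepresentation N)
  let rn : SmoothIrrep G := SmoothIrrep.mk (_ ⧸ N.toSubmodule) N.quotientRep hQ (hρ.quotientRep N)
  have hcons : ∀ c : IrrClass G, c.IsConstituentOf (Representation.normalizedInd t σ) ↔ (c = IrrClass.mk rn ∨ c = IrrClass.mk rs) :=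
    fun c => isConstituentOf_iff_of_isIrreducible hρ N hN hQ c
  -- exactness of `r` along `0 → N → ρ → ρ⁄N → 0`
  obtain ⟨hJinj, hJex, hJsurj⟩ := Representation.jacquet_exact_holds (k := ℂ) t hNlim (hρ.toRepresentation N) hρ
    (hρ.quotientRep N) (Subrepresentation.subtypeIntertwiningMap N) N.mkQ (Subrepresentation.subtypeIntertwiningMap_injective N)
    (exact_subtype_mkQ N) N.mkQ_surjective
  -- `r(ρ|_N) ≠ 0`: Frobenius on the inclusion
  haveI : Nontrivial ↥N.toSubmodule := Representation.IsIrreducible.nontrivial N.toRepresentation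
  haveI hJN : Nontrivial (t.restrict N.toRepresentation).Coinvariants :=
    nontrivial_coinvariants_of_injective_normalizedInd t hδ σ N.toRepresentation (hρ.toRepresentation N)
      (Subrepresentation.subtypeIntertwiningMap N) (Subrepresentation.subtypeIntertwiningMap_injective N)
  -- `r(ρ⁄N) ≠ 0`: the class `⟦ρ⁄N⟧` is a constituent, so a representative embeds into `i(σ)` or `i(σ')` (Cor. 6.3.9 (b)); Frobenius there
  haveI hJQ : Nontrivial (t.restrict N.quotientRep).Coinvariants := by
    obtain ⟨r, hr, hfr⟩ := hemb (IrrClass.mk rn) ((hcons _).2 (Or.inl rfl))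
    obtain ⟨e⟩ := (IrrClass.mk_eq_mk_iff r rn).1 hr
    haveI : Nontrivial r.V := Representation.IsIrreducible.nontrivial r.ρ
    haveI : Nontrivial (t.restrict r.ρ).Coinvariants := by
      rcases hfr with ⟨f, hf⟩ | ⟨f, hf⟩
      · exact nontrivial_coinvariants_of_injective_normalizedInd t hδ σ r.ρ r.isSmooth f hf
      · exact nontrivial_coinvariants_of_injective_normalizedInd t hδ σ' r.ρ r.isSmooth f hf
    exact (jacquetMap_equiv_injective t e).nontrivial
  -- the two cases
  haveI := hfd
  obtain ⟨hfdN, hfdQ, h1N, h1Q, hcases⟩ := Representation.normalizedJacquet_sub_quot_cases_of_line t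
    (Subrepresentation.subtypeIntertwiningMap N) N.mkQ hJinj hJex hJsurj h2 ℓ hℓ1 hℓ hq
  haveI := hfdN
  haveI := hfdQ
  -- distinct Jacquet characters on the two sides separate the classes
  have hsep : ∀ {ψ ψ' : ↥t.M →* ℂˣ}, ψ ≠ ψ' →
      (∀ (m : ↥t.M) (x : (t.restrict N.toRepresentation).Coinvariants), N.toRepresentation.normalizedJacquet t m x = ((ψ m : ℂˣ) : ℂ) • x) →
      (∀ (m : ↥t.M) (z : (t.restrict N.quotientRep).Coinvariants), N.quotientRep.normalizedJacquet t m z = ((ψ' m : ℂˣ) : ℂ) • z) →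
      IrrClass.mk rs ≠ IrrClass.mk rn := by
    intro ψ ψ' hψ hactN hactQ heq
    obtain ⟨e⟩ := (IrrClass.mk_eq_mk_iff _ _).1 heq
    have hexpQ : N.quotientRep.HasJacquetExponent t ψ :=
      (Representation.hasJacquetExponent_of_forall_eq_smul t hactN).map_of_injective t e.toIntertwiningMap
        (jacquetMap_equiv_injective t e)
    exact hψ (Representation.HasJacquetExponent.eq_of_forall_eq_smul t hactQ hexpQ)
  rcases hcases with ⟨hactN, hactQ⟩ | ⟨hactN, hactQ⟩
  · -- `ρ|_N` carries `θ₁` (it is `πn`), `ρ⁄N` carries `θ₂` (it is `πs`)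
    refine ⟨IrrClass.mk rn, IrrClass.mk rs, (hsep hne hactN hactQ).symm, fun c => (hcons c).trans Or.comm,
      ⟨rn, rfl, Representation.nonempty_normalizedJacquet_equiv_twist_of_finrank_eq_one t h1Q hactQ⟩,
      ⟨rs, rfl, Representation.nonempty_normalizedJacquet_equiv_twist_of_finrank_eq_one t h1N hactN⟩⟩
  · -- `ρ|_N` carries `θ₂` (it is `πs`), `ρ⁄N` carries `θ₁` (it is `πn`)
    refine ⟨IrrClass.mk rs, IrrClass.mk rn, hsep hne.symm hactN hactQ, hcons,
      ⟨rs, rfl, Representation.nonempty_normalizedJacquet_equiv_twist_of_finrank_eq_one t h1N hactN⟩,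
      ⟨rn, rfl, Representation.nonempty_normalizedJacquet_equiv_twist_of_finrank_eq_one t h1Q hactQ⟩⟩

end IrrClass

end Literature.NumberTheory.Automorphic

end
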